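import Summits.CriticalPhenomena.Ising3DConformalLimit.Theorems.EnergyNotSigmaSquaredGapForcesFarMergingScreeningDefs
import Literature.Probability.LatticeModels.RestrictedCorrelationMonotone

/-! # The ratio dictionary of the screening ladder (line `screening-form-lemma-a1` of crux
`GapForcesFarMerging`, item stmt-CriticalPhenomena-4468; helper file of the open stub `stub_floors`)

Finite-graph content (couplings `K ≥ 0` on a finite simple graph `G`; `Z_{G∖T}[B] = ecurrentSumIn (offGraph G T) K B`,
`⟨σ_B⟩_{Λ∖T} = Z_{G∖T}[B]/Z_{G∖T}[∅] = Current.offRatio K T B`). For NESTED obstacles `T ⊆ T'` and a probe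
pair `B = {a} ∆ {b}` the one-step ratio of the screening ladder `S_{ab}(T')/S_{ab}(T) = ⟨σ_aσ_b⟩_{Λ∖T'}/⟨σ_aσ_b⟩_{Λ∖T}`
is read through RESTRICTED SWITCHING (Aizenman–Duminil-Copin–Sidoravicius 2015, Lemma 2.2, nested form; tree
theorem `Current.ecurrentSumIn_empty_mul_ecurrentSum_pair`) applied to the depleted couplings `cutCoupling K T`:

* `nested_restricted_switching` — `Z_{G∖T'}[∅]·Z_{G∖T}[ab] = Z_{G∖T'}[ab]·Z_{G∖T}[∅] + D`, the DEFECT `D` being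
  the mass of the pairs `(n₁ ⊆ E(G∖T'), ∂n₁ = ∅)`, `(n₂ ⊆ E(G∖T), ∂n₂ = {a,b})` whose `a–b` connection does
  not survive off `T'`;
* `offRatio_eq_offRatio_add_defect` — the screening DROP `⟨σ_aσ_b⟩_{Λ∖T} - ⟨σ_aσ_b⟩_{Λ∖T'} = D/(Z_{G∖T'}[∅]Z_{G∖T}[∅])`,
  i.e. `S(T')/S(T) = 1 - P̃[a ↮ b off T']` under the normalised weights `P^∅_{G∖T'} ⊗ P^{ab}_{G∖T}`;
* `defect_le_hitting` — the cut event forces the duplicated cluster `C_{n₁+n₂}(a)` to meet `T' ∖ T`, whence the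
  FLOOR INEQUALITY `Z_{G∖T'}[∅]·Z_{G∖T}[ab] ≤ Z_{G∖T'}[ab]·Z_{G∖T}[∅] + (hitting mass of T' ∖ T)`
  (`nested_restricted_switching_le_hitting`), the starting point of any lower bound ("floor") on the octave
  ratio of the ladder `pinchScreen`.
References: ADS15 Lemma 2.2; ADC21 (arXiv:1912.07973) Appendix A, Lemma A.1. -/

noncomputable section

namespace Summit.CriticalPhenomena.Ising3DConformalLimit.EnergyNotSigmaSquaredGapForcesFarMerging

open scoped symmDiff ENNReal
open MeasureTheory Filter Finset
open Literature.Probability.LatticeModels Literature.Probability.Percolation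
open Summit.CriticalPhenomena.Ising3DConformalLimit.Theorems.GapForcesFarMerging.Negative (e₁ e₂ cc2 xR up dn)
open Summit.CriticalPhenomena.Ising3DConformalLimit.GapForcesFarMergingScreening

variable {V : Type*} [Fintype V] [DecidableEq V] {G : SimpleGraph V} [DecidableRel G.Adj] {K : G.edgeFinset → ℝ}

/-! ### Depleted couplings seen from a larger depletion -/

/-- A current living off `T'` lives off every `T ⊆ T'`. [folklore] -/
theorem isSupp_offGraph_mono {T T' : Finset V} (hT : T ⊆ T') {n : Current G}
    (hn : Current.IsSupp (offGraph G T') n) : Current.IsSupp (offGraph G T) n := by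
  rw [isSupp_offGraph_iff] at hn ⊢
  exact fun e he => hn e fun ho => he fun v hv hvT => ho v hv (hT hvT)

/-- On currents living off `T' ⊇ T` the couplings cut at `T` weigh like `K`. [folklore] -/
theorem eweight_cutCoupling_of_isSupp {T T' : Finset V} (hT : T ⊆ T') {n : Current G}
    (hn : Current.IsSupp (offGraph G T') n) : n.eweight (cutCoupling K T) = n.eweight K := by
  unfold Current.eweight
  rw [wweight_cutCoupling, if_pos (isSupp_offGraph_mono hT hn)]

/-- The weight for the couplings cut at `T`, as a restricted weight: `w_{K·1_{off T}}(n) = 1[n ⊆ E(G∖T)] w_K(n)`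
(`ℝ≥0∞`). [folklore] -/
theorem eweight_cutCoupling_eq_ite (T : Finset V) (n : Current G) :
    n.eweight (cutCoupling K T) = if Current.IsSupp (offGraph G T) n then n.eweight K else 0 := by
  unfold Current.eweight
  rw [wweight_cutCoupling]
  split_ifs <;> simp

/-- `Z_{G∖T', K·1_{off T}}[A] = Z_{G∖T'}[A]` for `T ⊆ T'`. [folklore] -/
theorem ecurrentSumIn_offGraph_cutCoupling_of_subset {T T' : Finset V} (hT : T ⊆ T') (A : Finset V) :
    ecurrentSumIn (offGraph G T') (cutCoupling K T) A = ecurrentSumIn (offGraph G T') K A := by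
  unfold ecurrentSumIn
  refine tsum_congr fun n => ?_
  by_cases h : Current.IsSupp (offGraph G T') n ∧ n.sources = A
  · rw [if_pos h, if_pos h, eweight_cutCoupling_of_isSupp hT h.1]
  · rw [if_neg h, if_neg h]

/-! ### Nested restricted switching with defect -/

/-- **Nested restricted switching with defect** (ADS15 Lemma 2.2 for the pair of depleted graphs
`G∖T' ≤ G∖T`, `T ⊆ T'`): `Z_{G∖T'}[∅] · Z_{G∖T}[{a,b}] = Z_{G∖T'}[{a,b}] · Z_{G∖T}[∅] + D(T,T';a,b)` with the defect
`D = ∑ 1{n₁ ⊆ E(G∖T'), ∂n₁ = ∅} 1{n₂ ⊆ E(G∖T), ∂n₂ = {a,b}} w w 1{¬(a ↔ b in E(G∖T') through n₁+n₂)}` — the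
tree's `Current.ecurrentSumIn_empty_mul_ecurrentSum_pair` for the couplings `cutCoupling K T`.
[cite: AizenmanDuminilCopinSidoraviciusCMP2015, Lemma 2.2] -/
theorem nested_restricted_switching' (hK : ∀ e, 0 ≤ K e) {T T' : Finset V} (hT : T ⊆ T') (a b : V) :
    ecurrentSumIn (offGraph G T') K ∅ * ecurrentSumIn (offGraph G T) K ({a} ∆ {b}) =
      ecurrentSumIn (offGraph G T') K ({a} ∆ {b}) * ecurrentSumIn (offGraph G T) K ∅ +
        ∑' p : Current G × Current G,
          (if Current.IsSupp (offGraph G T') p.1 ∧ p.1.sources = ∅ then p.1.eweight K else 0) *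
            (if Current.IsSupp (offGraph G T) p.2 ∧ p.2.sources = {a} ∆ {b} then p.2.eweight K else 0) *
            (Current.connIn (offGraph G T') a b)ᶜ.indicator 1 (p.1 + p.2) := by
  have h := Current.ecurrentSumIn_empty_mul_ecurrentSum_pair (offGraph G T') (cutCoupling_nonneg hK T) a b
  rw [ecurrentSumIn_offGraph_cutCoupling_of_subset hT, ecurrentSumIn_offGraph_cutCoupling_of_subset hT,
    ← ecurrentSumIn_offGraph_eq_cutCoupling, ← ecurrentSumIn_offGraph_eq_cutCoupling] at h
  have hdef : (∑' p : Current G × Current G,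
      (if Current.IsSupp (offGraph G T') p.1 ∧ p.1.sources = ∅ then p.1.eweight (cutCoupling K T) else 0) *
        (if p.2.sources = {a} ∆ {b} then p.2.eweight (cutCoupling K T) else 0) *
        (Current.connIn (offGraph G T') a b)ᶜ.indicator 1 (p.1 + p.2)) =
      ∑' p : Current G × Current G,
        (if Current.IsSupp (offGraph G T') p.1 ∧ p.1.sources = ∅ then p.1.eweight K else 0) *
          (if Current.IsSupp (offGraph G T) p.2 ∧ p.2.sources = {a} ∆ {b} then p.2.eweight K else 0) *
          (Current.connIn (offGraph G T') a b)ᶜ.indicator 1 (p.1 + p.2) := by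
    refine tsum_congr fun p => ?_
    have h1eq : (if Current.IsSupp (offGraph G T') p.1 ∧ p.1.sources = ∅ then p.1.eweight (cutCoupling K T) else 0)
        = (if Current.IsSupp (offGraph G T') p.1 ∧ p.1.sources = ∅ then p.1.eweight K else 0) := by
      by_cases h1 : Current.IsSupp (offGraph G T') p.1 ∧ p.1.sources = ∅
      · rw [if_pos h1, if_pos h1, eweight_cutCoupling_of_isSupp hT h1.1]
      · rw [if_neg h1, if_neg h1]
    have h2eq : (if p.2.sources = {a} ∆ {b} then p.2.eweight (cutCoupling K T) else 0)
        = (if Current.IsSupp (offGraph G T) p.2 ∧ p.2.sources = {a} ∆ {b} then p.2.eweight K else 0) := by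
      rw [eweight_cutCoupling_eq_ite]
      by_cases h2 : p.2.sources = {a} ∆ {b} <;>
        by_cases h3 : Current.IsSupp (offGraph G T) p.2 <;> simp [h2, h3]
    rw [h1eq, h2eq]
  rw [hdef] at h
  exact h

/-! ### The drop of the restricted correlation across `T' ∖ T` -/

/-- **The screening drop is the normalised defect**: for `T ⊆ T'`,
`⟨σ_aσ_b⟩_{Λ∖T} = ⟨σ_aσ_b⟩_{Λ∖T'} + D(T,T';a,b)/(Z_{G∖T'}[∅]·Z_{G∖T}[∅])`, i.e. dividing by `⟨σ_aσ_b⟩_{Λ∖T}`,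
`S_{ab}(T')/S_{ab}(T) = 1 - P̃[a ↮ b off T']` for the normalised pair weights `P^∅_{G∖T'} ⊗ P^{ab}_{G∖T}` (the
octave ratio of the screening ladder). [cite: AizenmanDuminilCopinSidoraviciusCMP2015, Lemma 2.2] -/
theorem offRatio_eq_offRatio_add_defect (hK : ∀ e, 0 ≤ K e) {T T' : Finset V} (hT : T ⊆ T') (a b : V) :
    Current.offRatio K T ({a} ∆ {b}) = Current.offRatio K T' ({a} ∆ {b}) +
      (∑' p : Current G × Current G,
          (if Current.IsSupp (offGraph G T') p.1 ∧ p.1.sources = ∅ then p.1.eweight K else 0) *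
            (if Current.IsSupp (offGraph G T) p.2 ∧ p.2.sources = {a} ∆ {b} then p.2.eweight K else 0) *
            (Current.connIn (offGraph G T') a b)ᶜ.indicator 1 (p.1 + p.2)) /
        (ecurrentSumIn (offGraph G T') K ∅ * ecurrentSumIn (offGraph G T) K ∅) := by
  have hN : ecurrentSumIn (offGraph G T) K ∅ ≠ 0 :=
    (lt_of_lt_of_le zero_lt_one (one_le_ecurrentSumIn_empty _ K)).ne'
  have hN' : ecurrentSumIn (offGraph G T') K ∅ ≠ 0 :=
    (lt_of_lt_of_le zero_lt_one (one_le_ecurrentSumIn_empty _ K)).ne'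
  have hNt : ecurrentSumIn (offGraph G T) K ∅ ≠ ∞ := ecurrentSumIn_ne_top _ hK _
  have hNt' : ecurrentSumIn (offGraph G T') K ∅ ≠ ∞ := ecurrentSumIn_ne_top _ hK _
  have h := nested_restricted_switching' hK hT a b
  have hdiv : ecurrentSumIn (offGraph G T') K ∅ * ecurrentSumIn (offGraph G T) K ({a} ∆ {b}) /
      (ecurrentSumIn (offGraph G T') K ∅ * ecurrentSumIn (offGraph G T) K ∅) =
      (ecurrentSumIn (offGraph G T') K ({a} ∆ {b}) * ecurrentSumIn (offGraph G T) K ∅ +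
        ∑' p : Current G × Current G,
          (if Current.IsSupp (offGraph G T') p.1 ∧ p.1.sources = ∅ then p.1.eweight K else 0) *
            (if Current.IsSupp (offGraph G T) p.2 ∧ p.2.sources = {a} ∆ {b} then p.2.eweight K else 0) *
            (Current.connIn (offGraph G T') a b)ᶜ.indicator 1 (p.1 + p.2)) /
      (ecurrentSumIn (offGraph G T') K ∅ * ecurrentSumIn (offGraph G T) K ∅) := by rw [h]
  rw [ENNReal.mul_div_mul_left _ _ hN' hNt', ENNReal.add_div, ENNReal.mul_div_mul_right _ _ hN hNt] at hdiv
  unfold Current.offRatio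
  exact hdiv

/-- Antitonicity of the restricted pair correlation in the deleted set, read off the dictionary:
`⟨σ_aσ_b⟩_{Λ∖T'} ≤ ⟨σ_aσ_b⟩_{Λ∖T}` for `T ⊆ T'` (Griffiths II; the ladder ratio is `≤ 1`).
[cite: AizenmanDuminilCopinAnnals2021, Appendix A, Corollary A.2] -/
theorem offRatio_pair_anti (hK : ∀ e, 0 ≤ K e) {T T' : Finset V} (hT : T ⊆ T') (a b : V) :
    Current.offRatio K T' ({a} ∆ {b}) ≤ Current.offRatio K T ({a} ∆ {b}) := by
  rw [offRatio_eq_offRatio_add_defect hK hT a b]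
  exact le_self_add

/-- The defect is at most the total mass: `D ≤ Z_{G∖T'}[∅] · Z_{G∖T}[{a,b}]` (`P̃[cut] ≤ 1`). [folklore] -/
theorem defect_le_mass (hK : ∀ e, 0 ≤ K e) {T T' : Finset V} (hT : T ⊆ T') (a b : V) :
    (∑' p : Current G × Current G,
        (if Current.IsSupp (offGraph G T') p.1 ∧ p.1.sources = ∅ then p.1.eweight K else 0) *
          (if Current.IsSupp (offGraph G T) p.2 ∧ p.2.sources = {a} ∆ {b} then p.2.eweight K else 0) *
          (Current.connIn (offGraph G T') a b)ᶜ.indicator 1 (p.1 + p.2)) ≤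
      ecurrentSumIn (offGraph G T') K ∅ * ecurrentSumIn (offGraph G T) K ({a} ∆ {b}) := by
  rw [nested_restricted_switching' hK hT a b]
  exact le_add_self

/-! ### The cut event forces the duplicated cluster to hit `T' ∖ T` -/

omit [Fintype V] [DecidableEq V] [DecidableRel G.Adj] in
/-- Open paths of a current living off `T` never enter `T`. [folklore] -/
theorem notMem_of_reachable_of_isSupp [Fintype V] [DecidableEq V] [DecidableRel G.Adj] {T : Finset V}
    {m : Current G} (hm : Current.IsSupp (offGraph G T) m) {x v : V}
    (h : (openGraph m.traced).Reachable x v) (hx : x ∉ T) : v ∉ T := by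
  obtain ⟨p⟩ := h
  induction p with
  | nil => exact hx
  | @cons u w _ huw _ ih =>
    refine ih ?_
    rw [openGraph_adj] at huw
    obtain ⟨he, _⟩ := huw
    have hG : s(u, w) ∈ G.edgeSet := Current.traced_subset_edgeSet m he
    have hpos : 0 < m ⟨s(u, w), (SimpleGraph.mem_edgeFinset).2 hG⟩ := (Current.mem_traced_iff m _).1 he
    exact (Current.isSupp_offGraph_iff' T m).1 hm _ hpos.ne' w (Sym2.mem_mk_right u w)

/-- **The cut event is a hitting event**: if `n₁ ⊆ E(G∖T')`, `n₂ ⊆ E(G∖T)` with `∂n₂ = {a} ∆ {b}`, `T ⊆ T'`,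
and `a ↮ b` through `E(G∖T')` in `n₁ + n₂`, then the duplicated cluster `C_{n₁+n₂}(a)` meets `T' ∖ T` (the `a–b`
path of `n₂` runs off `T`; its first vertex in `T'` is joined to `a`). [cite: AizenmanDuminilCopinSidoraviciusCMP2015, §3.2, eq. (3.7)] -/
theorem not_disjoint_cluster_of_not_connIn {T T' : Finset V} (hT : T ⊆ T') {n₁ n₂ : Current G} {a b : V}
    (h₁ : Current.IsSupp (offGraph G T') n₁) (h₂ : Current.IsSupp (offGraph G T) n₂)
    (hs : n₂.sources = {a} ∆ {b}) (hcut : n₁ + n₂ ∉ Current.connIn (offGraph G T') a b) :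
    ¬ Disjoint (T' \ T) ((n₁ + n₂).cluster a) := by
  intro hdis
  apply hcut
  rw [Current.mem_connIn_iff]
  by_cases hab : a = b
  · subst hab; exact SimpleGraph.Reachable.refl a
  have haT : a ∉ T := by
    have ha : a ∈ n₂.sources := by
      rw [hs, Finset.mem_symmDiff]; exact Or.inl ⟨Finset.mem_singleton_self a, by simpa using hab⟩
    exact Finset.mem_compl.1 (Current.sources_subset_compl_of_isSupp h₂ ha)
  have hsupp : Current.IsSupp (offGraph G T) (n₁ + n₂) := Current.isSupp_add (isSupp_offGraph_mono hT h₁) h₂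
  have hreach : (openGraph (n₁ + n₂).traced).Reachable a b :=
    Current.mem_cluster_iff.1 (Current.mem_cluster_add_of_sources_eq_right n₁ hs)
  refine Current.reachable_tracedIn_of_forall_mem (offGraph G T') (Λ := univ \ T') (fun v hv => ?_)
    (fun u w hu hw huw => ?_) hreach
  · rw [Finset.mem_sdiff]
    refine ⟨Finset.mem_univ v, fun hvT' => ?_⟩
    have hvT : v ∉ T := notMem_of_reachable_of_isSupp hsupp hv haT
    exact Finset.disjoint_left.1 hdis (Finset.mem_sdiff.2 ⟨hvT', hvT⟩) (Current.mem_cluster_iff.2 hv)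
  · rw [Finset.mem_sdiff] at hu hw
    exact offGraph_adj.2 ⟨huw, hu.2, hw.2⟩

/-- **The defect is at most the hitting mass of `T' ∖ T`**:
`D(T,T';a,b) ≤ ∑ 1{n₁ ⊆ E(G∖T'), ∂n₁ = ∅} 1{n₂ ⊆ E(G∖T), ∂n₂ = {a,b}} w w 1[C_{n₁+n₂}(a) ∩ (T' ∖ T) ≠ ∅]`.
[cite: AizenmanDuminilCopinSidoraviciusCMP2015, Lemma 2.2] -/
theorem defect_le_hitting {T T' : Finset V} (hT : T ⊆ T') (a b : V) :
    (∑' p : Current G × Current G,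
        (if Current.IsSupp (offGraph G T') p.1 ∧ p.1.sources = ∅ then p.1.eweight K else 0) *
          (if Current.IsSupp (offGraph G T) p.2 ∧ p.2.sources = {a} ∆ {b} then p.2.eweight K else 0) *
          (Current.connIn (offGraph G T') a b)ᶜ.indicator 1 (p.1 + p.2)) ≤
      ∑' p : Current G × Current G,
        (if Current.IsSupp (offGraph G T') p.1 ∧ p.1.sources = ∅ then p.1.eweight K else 0) *
          (if Current.IsSupp (offGraph G T) p.2 ∧ p.2.sources = {a} ∆ {b} then p.2.eweight K else 0) *
          (if Disjoint (T' \ T) ((p.1 + p.2).cluster a) then 0 else 1) := by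
  refine ENNReal.tsum_le_tsum fun p => ?_
  by_cases h1 : Current.IsSupp (offGraph G T') p.1 ∧ p.1.sources = ∅
  swap
  · simp only [if_neg h1, zero_mul, le_refl]
  by_cases h2 : Current.IsSupp (offGraph G T) p.2 ∧ p.2.sources = {a} ∆ {b}
  swap
  · simp only [if_neg h2, mul_zero, zero_mul, le_refl]
  refine mul_le_mul' le_rfl ?_
  by_cases hcut : p.1 + p.2 ∈ Current.connIn (offGraph G T') a b
  · rw [Set.indicator_of_notMem (fun h => (Set.mem_compl_iff _ _).1 h hcut)]
    exact bot_le
  · rw [Set.indicator_of_mem (Set.mem_compl hcut), Pi.one_apply,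
      if_neg (not_disjoint_cluster_of_not_connIn hT h1.1 h2.1 h2.2 hcut)]

/-- **The floor inequality in dictionary form**: for `T ⊆ T'`,
`Z_{G∖T'}[∅]·Z_{G∖T}[{a,b}] ≤ Z_{G∖T'}[{a,b}]·Z_{G∖T}[∅] + (hitting mass of T' ∖ T by C_{n₁+n₂}(a))`, i.e.
`S_{ab}(T')/S_{ab}(T) ≥ 1 - P̃[C_{n₁+n₂}(a) ∩ (T' ∖ T) ≠ ∅]` under `P^∅_{G∖T'} ⊗ P^{ab}_{G∖T}`: a FLOOR on the ladder
ratio is an upper bound `< 1` on a hitting probability of the annulus piece by the fresh dressed probe.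
[cite: AizenmanDuminilCopinSidoraviciusCMP2015, Lemma 2.2] -/
theorem nested_restricted_switching_le_hitting (hK : ∀ e, 0 ≤ K e) {T T' : Finset V} (hT : T ⊆ T')
    (a b : V) :
    ecurrentSumIn (offGraph G T') K ∅ * ecurrentSumIn (offGraph G T) K ({a} ∆ {b}) ≤
      ecurrentSumIn (offGraph G T') K ({a} ∆ {b}) * ecurrentSumIn (offGraph G T) K ∅ +
        ∑' p : Current G × Current G,
          (if Current.IsSupp (offGraph G T') p.1 ∧ p.1.sources = ∅ then p.1.eweight K else 0) *
            (if Current.IsSupp (offGraph G T) p.2 ∧ p.2.sources = {a} ∆ {b} then p.2.eweight K else 0) *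
            (if Disjoint (T' \ T) ((p.1 + p.2).cluster a) then 0 else 1) := by
  rw [nested_restricted_switching' hK hT a b]
  exact add_le_add le_rfl (defect_le_hitting (G := G) (K := K) hT a b)

/-! ### The registered form (closed statement over `V : Type`) -/

/-- **RATIO DICTIONARY of the screening ladder** (registered helper of `stub_floors`): for couplings `K ≥ 0` on a
finite graph, nested obstacles `T ⊆ T'` and a probe pair `{a,b}`,
`Z_{G∖T'}[∅]·Z_{G∖T}[{a,b}] = Z_{G∖T'}[{a,b}]·Z_{G∖T}[∅] + ∑ 1{n₁ ⊆ E(G∖T'),∂n₁=∅}1{n₂ ⊆ E(G∖T),∂n₂={a,b}} w w 1{a ↮ b off T'}`,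
so that `⟨σ_aσ_b⟩_{Λ∖T'}/⟨σ_aσ_b⟩_{Λ∖T} = 1 - P^∅_{Λ∖T'} ⊗ P^{ab}_{Λ∖T}[a ↮ b off T']`.
[cite: AizenmanDuminilCopinSidoraviciusCMP2015, Lemma 2.2] -/
theorem nested_restricted_switching : ∀ (V : Type) [Fintype V] [DecidableEq V] (G : SimpleGraph V) [DecidableRel G.Adj] (K : G.edgeFinset → ℝ), (∀ e, 0 ≤ K e) → ∀ (T T' : Finset V), T ⊆ T' → ∀ a b : V, ecurrentSumIn (offGraph G T') K ∅ * ecurrentSumIn (offGraph G T) K ({a} ∆ {b}) = ecurrentSumIn (offGraph G T') K ({a} ∆ {b}) * ecurrentSumIn (offGraph G T) K ∅ + ∑' p : Current G × Current G, (if Current.IsSupp (offGraph G T') p.1 ∧ p.1.sources = ∅ then p.1.eweight K else 0) * (if Current.IsSupp (offGraph G T) p.2 ∧ p.2.sources = {a} ∆ {b} then p.2.eweight K else 0) * (Current.connIn (offGraph G T') a b)ᶜ.indicator 1 (p.1 + p.2) :=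
  fun _ _ _ _ _ _ hK _ _ hT a b => nested_restricted_switching' hK hT a b

/-- **FLOOR INEQUALITY of the screening ladder, dictionary form** (registered helper of `stub_floors`): for
couplings `K ≥ 0` on a finite graph, nested obstacles `T ⊆ T'` and a probe pair `{a,b}`,
`Z_{G∖T'}[∅]·Z_{G∖T}[{a,b}] ≤ Z_{G∖T'}[{a,b}]·Z_{G∖T}[∅] + ∑ 1{n₁ ⊆ E(G∖T'),∂n₁=∅}1{n₂ ⊆ E(G∖T),∂n₂={a,b}} w w 1[C_{n₁+n₂}(a) ∩ (T'∖T) ≠ ∅]`,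
i.e. `⟨σ_aσ_b⟩_{Λ∖T'}/⟨σ_aσ_b⟩_{Λ∖T} ≥ 1 - P^∅_{Λ∖T'} ⊗ P^{ab}_{Λ∖T}[C_{n₁+n₂}(a) ∩ (T' ∖ T) ≠ ∅]`.
[cite: AizenmanDuminilCopinSidoraviciusCMP2015, Lemma 2.2] -/
theorem screening_ratio_floor_by_hitting : ∀ (V : Type) [Fintype V] [DecidableEq V] (G : SimpleGraph V) [DecidableRel G.Adj] (K : G.edgeFinset → ℝ), (∀ e, 0 ≤ K e) → ∀ (T T' : Finset V), T ⊆ T' → ∀ a b : V, ecurrentSumIn (offGraph G T') K ∅ * ecurrentSumIn (offGraph G T) K ({a} ∆ {b}) ≤ ecurrentSumIn (offGraph G T') K ({a} ∆ {b}) * ecurrentSumIn (offGraph G T) K ∅ + ∑' p : Current G × Current G, (if Current.IsSupp (offGraph G T') p.1 ∧ p.1.sources = ∅ then p.1.eweight K else 0) * (if Current.IsSupp (offGraph G T) p.2 ∧ p.2.sources = {a} ∆ {b} then p.2.eweight K else 0) * (if Disjoint (T' \ T) ((p.1 + p.2).cluster a) then 0 else 1) :=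
  fun _ _ _ _ _ _ hK _ _ hT a b => nested_restricted_switching_le_hitting hK hT a b

/-- **SCREENING DROP = NORMALISED DEFECT** (registered helper of `stub_floors`): for couplings `K ≥ 0` on a
finite graph, nested obstacles `T ⊆ T'` and a probe pair `{a,b}`,
`⟨σ_aσ_b⟩_{Λ∖T} = ⟨σ_aσ_b⟩_{Λ∖T'} + D(T,T';a,b)/(Z_{G∖T'}[∅]·Z_{G∖T}[∅])` in `ℝ≥0∞`
(`⟨σ_B⟩_{Λ∖T} = Current.offRatio K T B`). [cite: AizenmanDuminilCopinSidoraviciusCMP2015, Lemma 2.2] -/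
theorem screening_drop_eq_defect : ∀ (V : Type) [Fintype V] [DecidableEq V] (G : SimpleGraph V) [DecidableRel G.Adj] (K : G.edgeFinset → ℝ), (∀ e, 0 ≤ K e) → ∀ (T T' : Finset V), T ⊆ T' → ∀ a b : V, Current.offRatio K T ({a} ∆ {b}) = Current.offRatio K T' ({a} ∆ {b}) + (∑' p : Current G × Current G, (if Current.IsSupp (offGraph G T') p.1 ∧ p.1.sources = ∅ then p.1.eweight K else 0) * (if Current.IsSupp (offGraph G T) p.2 ∧ p.2.sources = {a} ∆ {b} then p.2.eweight K else 0) * (Current.connIn (offGraph G T') a b)ᶜ.indicator 1 (p.1 + p.2)) / (ecurrentSumIn (offGraph G T') K ∅ * ecurrentSumIn (offGraph G T) K ∅) :=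
  fun _ _ _ _ _ _ hK _ _ hT a b => offRatio_eq_offRatio_add_defect hK hT a b

end Summit.CriticalPhenomena.Ising3DConformalLimit.EnergyNotSigmaSquaredGapForcesFarMerging

end
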